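import Literature.MathematicalPhysics.QuantumFieldTheory.Balaban1983to89.B9SectCDiffCutModelToy15

/-!
# `Balaban1983to89.B9SectCDiffCutModelToy16` — HONESTY FOR THE SHADOW CONFIGURATION AT THE LEVEL OF THE FINE
PROPAGATORS: strict positivity of the massive resolvent on the toy line, strict monotonicity in the potential, and
the NON-VANISHING of the propagator defect `𝔇(G′)` of Toy15's shadow datum `Xsh` at a site where the cutoff is
`≡ 1`, `M` blocks away from the support of the potential — while its local defect `𝔇(A′)` vanishes identically
(census `b2b-balaban-r1/SectC-inst-census.md` §6 (a⁵), note N21 (6)(i) and note N21b)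

B9 = T. Bałaban, *Propagators for lattice gauge theories in a background field*, Commun. Math. Phys. **99**, 389–434
(1985) [Balaban1985BackgroundPropagators].

CITATION HEADER (lean-in-tree rule 2026-08-18).  Cell `pub-balaban`, unit `b2b-balaban-r1-g21` (READER GROUP A,
lineage r1, gen 21), journal claim `SECTC-DIFF-TOY-GPOS` (second claim of the seat; successor of the same unit's
`…Toy15` under claim `SECTC-DIFF-CUTMODEL-TOY15`).  Source: doi:10.1007/bf01240355, held
`paper:balaban1985-cmp99-background-propagators`.  This unit re-read NO page and introduces NO quotation; the only
printed shape in the background is the left side of (3.97), p. 412 [PDF 24], typed as `TwoSeq.dT` / the defects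
`TwoSeq.dG'`, `TwoSeq.dA'` of `…B9SectCDiffExpansion` (quotations in the headers of `…B9SectCDiffEstimate` /
`…B9SectCDiffExpansion`); the present declarations point to them BY NAME only.  Tree inputs (by name):
`B9SectCDiff.{tdef, tdef_def}`, `B9SectCDiffExpansion.{TwoSeq.dG', TwoSeq.dA', TwoSeq.dE}`, `B9SectCDiffCutModel.cutX_id_id`,
`B9SectCDiffCutModelToy.{xS}`, `B9SectCDiffCutModelToy6.E2`, `B9SectCDiffCutModelToy8.coarse_apply`,
`B9SectCDiffCutModelToy.{ramp_eq_one_of_ge}`, `B9SectCDiffCutModelToy4.{ι, ι_eq, ι_lt, sstep_one, h4, h4_eq,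
lt_of_hIM}`, `B9SectCDiffCutModelToy5.{Gr, Gr_nonneg, U, U_ι, U_nonneg, rec_int, rec_zero, src_int, src_zero}`,
`B9SectCDiffCutModelToy10.muB_pos`, `B9SectCDiffCutModelToy11.{Gv, Gv_nonneg, Gv_le_Gr, Gr_le_Gv, Gv_eq_sub_left, GvGv_le, Ev,
ha20_of, haB_of}`, `B9SectCDiffCutModelToy12.hBnat_of`, `B9SectCDiffCutModelToy15.{Xhv, Xsh, vsh, vsh_nonneg, vsh_le,
vsh_base_ne_zero, h4_base, h4_mul_vsh, Xsh_G'₂_ne_G'₁}`; Mathlib otherwise.  Cell rows: GAPS C-r1g21-1 (Toy15), this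
module's row C-r1g21-2; census note N21b.  No `HarnessLib` fact, no named-fact `Prop`, no `instance`, no new
predicate; no `sorry`.

## WHAT THIS MODULE DOES

Toy15's headline `XshD_dT_entry` bounds `|𝔇(T)(I, J)|` for the shadow datum `Xsh` (two operator sequences that
differ by a potential hidden where the cutoff `h₄` vanishes), and its caveat (1) records that the left side is not
certified non-zero.  This module certifies non-degeneracy ONE LEVEL DOWN, for the fine (scalar) propagators
`G′₁ = G′(μ)`, `G′₂ = G_v` that feed the expansion:

* §1 **STRICT POSITIVITY OF THE MASSIVE RESOLVENT ON THE TOY LINE**: `G′(μ)(x, y) > 0` for ALL sites (`Gr_pos`),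
  from Toy5's row equations: a zero entry of a column propagates site by site towards the source (the rows away
  from the source are `(2+μ)U(i) = U(i+1) + U(i−1)`, `(1+μ)U(0) = U(1)`, all entries `≥ 0`), and at the source
  row `(2+μ)U = U₊ + U₋ + 1` it is absurd (`U_eq_zero_false`, `U_pos`).  Hence `G_v > 0` (`Gv_pos`, by Toy11's
  comparison `G′(μ+t) ≤ G_v`) and the STRICT monotonicity in the potential **`G_v(x, y) < G′(x, y)` for every pair
  of sites as soon as `v ≢ 0`** (`Gv_lt_Gr`: the resolvent identity `G′ − G_v = G′·diag v·G_v` entrywise, one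
  strictly positive term).
  The same one coarse level up: `(G_v²)(x, z) < (G′²)(x, z)` (`GvGv_lt_GrGr`), a strict coarse-sandwich
  comparison (`coarse_lt`, Toy8's `coarse_apply`), hence **`E_v(I, J) < E₂(I, J)` for all blocks** (`Ev_lt_E2`;
  Toy11 had `≤`).
* §2 **THE DEFECTS `𝔇(G′)`, `𝔇(A′)`, `𝔇(E)` OF THE DATUM `Xhv`** in closed form: `𝔇(G′)(x, y) = h₄(x)·G_v(x, y) −
  G′(x, y)·h₄(y)` (`Xhv_dG'_apply`, `Xhv_dG'_split`), `𝔇(A′) = diag(h₄·v)` (`Xhv_dA'`), `𝔇(E)(I, J) =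
  h₄(x_S I)·E_v(I, J) − E₂(I, J)·h₄(x_S J)` (`Xhv_dE_apply`; `E = Q′G′²Q′*`, the coarse operator whose inverse is
  the slot `C`); `h₄ = 1` at the base site of block `I₀ + M` (`h4_top`).
* §3 **THE SHADOW CONFIGURATION IS NON-DEGENERATE WHERE THE CUTOFF IS `≡ 1`**: for `Xsh` (potential `3(a/B)²` on
  the ramp-zone sites with `h₄ = 0`): the LOCAL defect vanishes identically, **`𝔇(A′) = 0`** (`Xsh_dA'_eq_zero` —
  the cutoff never sees the potential), yet the PROPAGATOR defect does not: at the pair (top, base) it is the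
  commutator part `G_v(x_top, z₀) > 0` (`Xsh_dG'_top_base_pos`), and at the diagonal entry of the top site
  `x_top = (I₀ + M, 0)`, where `h₄ ≡ 1` and the commutator part vanishes, it is the pure TWO-BACKGROUND part
  **`𝔇(G′)(x_top, x_top) = G_v(x_top, x_top) − G′(x_top, x_top) < 0`** (`Xsh_dG'_top_top_neg`): the potential
  hidden `M` blocks away behind the foot of the ramp is felt through the resolvent where the cutoff is `1`.
  ON THE COARSE (BLOCK) LEVEL — where Toy15's headline `𝔇(T)(I, J)` lives — the defect of the coarse operator `E`
  at the top block `I_top = I₀ + M` is the pure two-background quantity **`𝔇(E)(I_top, I_top) = E_v(I_top, I_top) −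
  E₂(I_top, I_top) < 0`** (`Xsh_dE_top_top_neg`, `Xsh_dE_ne_zero`).  `Xsh_nondegenerate` bundles the facts
  (`𝔇(A′) = 0`, `𝔇(G′) ≠ 0`, `𝔇(E) ≠ 0`, `G′₂ ≠ G′₁`).

HONEST CAVEATS.  (1) This does NOT certify Toy15's headline left side `𝔇(T) ≠ 0`: `T = Q′·G·Q′*` involves the
Woodbury propagators `Gtoy`, `G_v,toy` (differences `∂`, mixed signs), for which the cell has no entrywise sign
information; `T₂ ≠ T₁` stays open (census N21 (6)(i)).  (2) No quantitative lower bound is claimed (the certified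
quantities are exponentially small in `M·B·√μ`); the statements are strict inequalities only.  (3) One-dimensional
TOY, one level — NOT summit progress; nothing here bears on B9's Theorems 3.1–3.3.  Value = kernel certificate that
the shadow configuration of Toy15 is not a disguised equal-sequence datum at the level of the fine propagators:
zero local defect, non-zero propagator defect on `{h₄ = 1}`, non-zero coarse-operator defect at the top block.
-/

namespace Literature.MathematicalPhysics.QuantumFieldTheory.Balaban1983to89.B9SectCDiffCutModelToy16

open Finset Real
open B9SectCDiffExpansion (TwoSeq)
open B9SectCDiffCutModelToy
open B9SectCDiffCutModelToy2
open B9SectCDiffCutModelToy4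
open B9SectCDiffCutModel (cutX_id_id)
open B9SectCDiffCutModelToy5
open B9SectCDiffCutModelToy6
open B9SectCDiffCutModelToy8
open B9SectCDiffCutModelToy10
open B9SectCDiffCutModelToy11
open B9SectCDiffCutModelToy12
open B9SectCDiffCutModelToy15
open B9SectCDiff (tdef cutX)

noncomputable section

/-! ## §1 Strict positivity of the massive resolvent on the toy line; strict monotonicity in the potential -/

section Positivity

variable {n B : ℕ} {μ t : ℝ} {v : Fin n × Fin B → ℝ} {y : Fin n × Fin B}

/-- **A ZERO ENTRY IS ABSURD**: if the column `U(·) = G′(site ·, y)` of Toy5 vanished at a site at distance `k`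
from the source `ι y` (on either side), then — walking towards the source with the rows `(2+μ)U(i) = U(i+1) +
U(i−1)` / `(1+μ)U(0) = U(1)` and `U ≥ 0` — it would vanish AT the source, contradicting the source row
`(2+μ)U(ιy) = U(ιy+1) + U(ιy−1) + 1` (resp. `(1+μ)U(0) = U(1) + 1`).  Induction on `k`. [folklore] -/
theorem U_eq_zero_false (hμ : 0 < μ) :
    ∀ k i, i < n * B → (i + k = ι y ∨ ι y + k = i) → U n B μ y i = 0 → False
  | 0, i, hi, h, h0 => by
      have hiy : ι y = i := by omega
      by_cases hb : ι y = 0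
      · have hs := src_zero (y := y) hμ hb
        have hi0 : i = 0 := by omega
        rw [hi0] at h0
        rw [h0, mul_zero] at hs
        linarith [U_nonneg y hμ 1]
      · have hs := src_int (y := y) hμ hb
        rw [hiy, h0, mul_zero] at hs
        linarith [U_nonneg y hμ (i + 1), U_nonneg y hμ (i - 1)]
  | k + 1, i, hi, h, h0 => by
      have hyL := ι_lt y
      rcases h with h | h
      · -- left of the source: the zero moves one site to the right
        have h1 : U n B μ y (i + 1) = 0 := by
          by_cases hi0 : i = 0
          · have hr := rec_zero (y := y) hμ (lt_of_le_of_lt (Nat.zero_le _) hi) (by omega)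
            rw [hi0]
            rw [hi0] at h0
            rw [h0, mul_zero] at hr
            exact hr.symm
          · have hr := rec_int (y := y) hμ hi0 hi (by omega)
            rw [h0, mul_zero] at hr
            linarith [U_nonneg y hμ (i + 1), U_nonneg y hμ (i - 1)]
        exact U_eq_zero_false hμ k (i + 1) (by omega) (Or.inl (by omega)) h1
      · -- right of the source: the zero moves one site to the left
        have hi0 : i ≠ 0 := by omega
        have hr := rec_int (y := y) hμ hi0 hi (by omega)
        rw [h0, mul_zero] at hr
        have h1 : U n B μ y (i - 1) = 0 := by
          linarith [U_nonneg y hμ (i + 1), U_nonneg y hμ (i - 1)]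
        exact U_eq_zero_false hμ k (i - 1) (by omega) (Or.inr (by omega)) h1

/-- **the column is STRICTLY POSITIVE at every site**. [folklore] -/
theorem U_pos (hμ : 0 < μ) {i : ℕ} (hi : i < n * B) : 0 < U n B μ y i :=
  lt_of_le_of_ne (U_nonneg y hμ i) fun h => by
    rcases le_total i (ι y) with hle | hle
    · exact U_eq_zero_false hμ (ι y - i) i hi (Or.inl (by omega)) h.symm
    · exact U_eq_zero_false hμ (i - ι y) i hi (Or.inr (by omega)) h.symm

/-- **STRICT POSITIVITY OF THE MASSIVE RESOLVENT ON THE TOY LINE**: `G′(μ)(x, y) > 0` for all sites `x, y`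
(`μ > 0`; the inverse of the irreducible M-matrix `H_μ`). [folklore] -/
theorem Gr_pos (hμ : 0 < μ) (x y : Fin n × Fin B) : 0 < Gr n B μ x y := by
  rw [← U_ι y x]
  exact U_pos hμ (ι_lt x)

/-- **STRICT POSITIVITY OF THE RESOLVENT WITH A POTENTIAL**: `G_v(x, y) > 0` for `0 ≤ v ≤ t` (Toy11's comparison
`G′(μ+t) ≤ G_v` and `Gr_pos` at mass `μ + t`). [folklore] -/
theorem Gv_pos (hμ : 0 < μ) (hv0 : ∀ x, 0 ≤ v x) (hv1 : ∀ x, v x ≤ t) (x y : Fin n × Fin B) :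
    0 < Gv n B μ v x y := by
  have ht : 0 ≤ t := (hv0 x).trans (hv1 x)
  have hμt : 0 < μ + t := by positivity
  exact lt_of_lt_of_le (Gr_pos hμt x y) (Gr_le_Gv hμ hv0 hv1 x y)

/-- the resolvent identity ENTRYWISE: `G′(x, y) − G_v(x, y) = Σ_z G′(x, z)·v(z)·G_v(z, y)` (Toy11's
`Gv_eq_sub_left`). [folklore] -/
theorem Gr_sub_Gv_apply (hμ : 0 < μ) (hv0 : ∀ x, 0 ≤ v x) (x y : Fin n × Fin B) :
    Gr n B μ x y - Gv n B μ v x y = ∑ z, Gr n B μ x z * v z * Gv n B μ v z y := by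
  have e := congrFun (congrFun (Gv_eq_sub_left (n := n) (B := B) (v := v) hμ hv0) x) y
  rw [Matrix.sub_apply, Matrix.mul_apply] at e
  simp only [Matrix.mul_diagonal] at e
  rw [e]
  ring

/-- **STRICT MONOTONICITY IN THE POTENTIAL**: if `0 ≤ v ≤ t` and `v(z₀) > 0` at ONE site, then
`G_v(x, y) < G′(μ)(x, y)` for EVERY pair of sites — the term `G′(x, z₀)·v(z₀)·G_v(z₀, y)` of the resolvent
identity is strictly positive and the others are `≥ 0`. [folklore] -/
theorem Gv_lt_Gr (hμ : 0 < μ) (hv0 : ∀ x, 0 ≤ v x) (hv1 : ∀ x, v x ≤ t) {z₀ : Fin n × Fin B}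
    (hz : 0 < v z₀) (x y : Fin n × Fin B) : Gv n B μ v x y < Gr n B μ x y := by
  have key : Gr n B μ x z₀ * v z₀ * Gv n B μ v z₀ y ≤ ∑ z, Gr n B μ x z * v z * Gv n B μ v z y :=
    Finset.single_le_sum (f := fun z => Gr n B μ x z * v z * Gv n B μ v z y)
      (fun z _ => mul_nonneg (mul_nonneg (Gr_nonneg hμ _ _) (hv0 z)) (Gv_nonneg hμ hv0 _ _))
      (Finset.mem_univ z₀)
  have hpos : 0 < Gr n B μ x z₀ * v z₀ * Gv n B μ v z₀ y :=
    mul_pos (mul_pos (Gr_pos hμ _ _) hz) (Gv_pos hμ hv0 hv1 _ _)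
  have e := Gr_sub_Gv_apply hμ hv0 x y (v := v)
  linarith

/-- **STRICT comparison of the squares**: `(G_v²)(x, z) < (G′²)(x, z)` for all sites, as soon as `v ≢ 0` (every term
`G_v(x, w)G_v(w, z) ≤ G′(x, w)G′(w, z)`, strictly at `w = x`). [folklore] -/
theorem GvGv_lt_GrGr (hμ : 0 < μ) (hv0 : ∀ x, 0 ≤ v x) (hv1 : ∀ x, v x ≤ t) {z₀ : Fin n × Fin B}
    (hz : 0 < v z₀) (x z : Fin n × Fin B) :
    (Gv n B μ v * Gv n B μ v) x z < (Gr n B μ * Gr n B μ) x z := by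
  rw [Matrix.mul_apply, Matrix.mul_apply]
  exact Finset.sum_lt_sum
    (fun w _ => mul_le_mul (Gv_le_Gr hμ hv0 x w) (Gv_le_Gr hμ hv0 w z) (Gv_nonneg hμ hv0 w z)
      (Gr_nonneg hμ x w))
    ⟨x, Finset.mem_univ _, mul_lt_mul (Gv_lt_Gr hμ hv0 hv1 hz x x) (Gv_le_Gr hμ hv0 x z)
      (Gv_pos hμ hv0 hv1 x z) (Gr_nonneg hμ x x)⟩

/-- **a STRICT coarse-sandwich comparison**: if `M ≤ N` entrywise with strict inequality everywhere and `0 < B`,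
then `(Q′·M·Q′*)(I, J) < (Q′·N·Q′*)(I, J)` (Toy8's `coarse_apply`: the entries are `B⁻¹` times block double
sums over non-empty blocks). [folklore] -/
theorem coarse_lt {M N : Matrix (Fin n × Fin B) (Fin n × Fin B) ℝ} (hB : 0 < B) (hle : ∀ x z, M x z ≤ N x z)
    (hlt : ∀ x z, M x z < N x z) (I J : Fin n) :
    (Qp n B * M * Qpt n B) I J < (Qp n B * N * Qpt n B) I J := by
  rw [coarse_apply, coarse_apply]
  have hBr : (0 : ℝ) < B := by exact_mod_cast hB
  refine mul_lt_mul_of_pos_left ?_ (inv_pos.mpr hBr)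
  refine Finset.sum_lt_sum (fun x _ => Finset.sum_le_sum fun z _ => hle x z)
    ⟨xS hB I, Finset.mem_filter.2 ⟨Finset.mem_univ _, rfl⟩, ?_⟩
  exact Finset.sum_lt_sum (fun z _ => hle _ z) ⟨xS hB J, Finset.mem_filter.2 ⟨Finset.mem_univ _, rfl⟩, hlt _ _⟩

/-- **THE COARSE OPERATORS DIFFER STRICTLY, EVERY ENTRY**: `E_v(I, J) < E₂(I, J)` for all blocks as soon as
`v ≢ 0` (`E_v = Q′G_v²Q′*`, `E₂ = Q′G′²Q′*`; Toy11's `Ev_le_E2` is the non-strict form). [folklore] -/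
theorem Ev_lt_E2 (hμ : 0 < μ) (hv0 : ∀ x, 0 ≤ v x) (hv1 : ∀ x, v x ≤ t) {z₀ : Fin n × Fin B} (hz : 0 < v z₀)
    (hB : 0 < B) (I J : Fin n) : Ev n B μ v I J < E2 n B μ I J := by
  unfold Ev E2
  exact coarse_lt hB (GvGv_le hμ hv0) (GvGv_lt_GrGr hμ hv0 hv1 hz) I J

end Positivity

/-! ## §2 The defects `𝔇(G′)`, `𝔇(A′)` of the datum `Xhv` in closed form; the top site of the ramp -/

section Defects

variable {n B M I₀ : ℕ} {a t : ℝ} {v : Fin n × Fin B → ℝ} {ha : 16777216 ≤ a} {haB : 2 * a ≤ (B : ℝ)}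
  {hv0 : ∀ x, 0 ≤ v x} {hv1 : ∀ x, v x ≤ 3 * (a / B) ^ 2}

/-- **THE PROPAGATOR DEFECT OF `Xhv` IN CLOSED FORM**: `𝔇(G′)(x, y) = h₄(x)·G_v(x, y) − G′(x, y)·h₄(y)`
(`𝔇(G′) = χ·G′₂ − G′₁·χ` with `χ = diag(h₄)`, `G′₁ = G′(μ)`, `G′₂ = G_v`, `μ = (a/B)²`). [folklore] -/
theorem Xhv_dG'_apply (x y : Fin n × Fin B) :
    (Xhv n B M I₀ a v ha haB hv0 hv1).dG' x y =
      h4 n B M I₀ x * Gv n B ((a / B) ^ 2) v x y - Gr n B ((a / B) ^ 2) x y * h4 n B M I₀ y := by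
  show tdef (Matrix.diagonal (h4 n B M I₀)) (Matrix.diagonal (h4 n B M I₀))
      (Gr n B ((a / B) ^ 2)) (Gv n B ((a / B) ^ 2) v) x y = _
  rw [B9SectCDiff.tdef_def, Matrix.sub_apply, Matrix.diagonal_mul, Matrix.mul_diagonal]

/-- **THE SPLIT** of the propagator defect: `𝔇(G′)(x, y) = h₄(x)·(G_v − G′)(x, y) + (h₄(x) − h₄(y))·G′(x, y)` —
the cutoff times the genuine two-background difference, plus the commutator `[diag h₄, G′]`. [folklore] -/
theorem Xhv_dG'_split (x y : Fin n × Fin B) :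
    (Xhv n B M I₀ a v ha haB hv0 hv1).dG' x y =
      h4 n B M I₀ x * (Gv n B ((a / B) ^ 2) v x y - Gr n B ((a / B) ^ 2) x y)
        + (h4 n B M I₀ x - h4 n B M I₀ y) * Gr n B ((a / B) ^ 2) x y := by
  rw [Xhv_dG'_apply]; ring

/-- **THE LOCAL DEFECT OF `Xhv` IN CLOSED FORM**: `𝔇(A′) = diag(h₄)·diag(v) − 0·diag(h₄) = diag(h₄·v)`.
[folklore] -/
theorem Xhv_dA' :
    (Xhv n B M I₀ a v ha haB hv0 hv1).dA' = Matrix.diagonal fun x => h4 n B M I₀ x * v x := by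
  show tdef (Matrix.diagonal (h4 n B M I₀)) (Matrix.diagonal (h4 n B M I₀))
      (0 : Matrix (Fin n × Fin B) (Fin n × Fin B) ℝ) (Matrix.diagonal v) = _
  rw [B9SectCDiff.tdef_def, Matrix.zero_mul, sub_zero, Matrix.diagonal_mul_diagonal]

/-- **THE COARSE-OPERATOR DEFECT OF `Xhv` IN CLOSED FORM**: `𝔇(E)(I, J) = h₄(x_S I)·E_v(I, J) − E₂(I, J)·h₄(x_S J)`
(`𝔇(E) = ψ·E₂ − E₁·ψ` with `ψ = cutX id id (h₄ ∘ x_S) = diag(h₄ ∘ x_S)`, `E₁ = Q′G′²Q′* = E₂(μ)`,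
`E₂ = Q′G_v²Q′* = E_v`). [folklore] -/
theorem Xhv_dE_apply (I J : Fin n) :
    (Xhv n B M I₀ a v ha haB hv0 hv1).dE I J =
      h4 n B M I₀ (xS (hBnat_of ha haB) I) * Ev n B ((a / B) ^ 2) v I J
        - E2 n B ((a / B) ^ 2) I J * h4 n B M I₀ (xS (hBnat_of ha haB) J) := by
  show tdef (cutX id id fun I => h4 n B M I₀ (xS (hBnat_of ha haB) I))
      (cutX id id fun I => h4 n B M I₀ (xS (hBnat_of ha haB) I))
      (Qp n B * Gr n B ((a / B) ^ 2) * Gr n B ((a / B) ^ 2) * Qpt n B)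
      (Qp n B * Gv n B ((a / B) ^ 2) v * Gv n B ((a / B) ^ 2) v * Qpt n B) I J = _
  rw [cutX_id_id, B9SectCDiff.tdef_def, Matrix.sub_apply, Matrix.diagonal_mul, Matrix.mul_diagonal]
  simp only [Ev, E2, Matrix.mul_assoc]

/-- **THE TOP SITE OF THE RAMP**: `h₄ = 1` at the base site `(I₀ + M, 0)` of block `I₀ + M` (there
`ι = (I₀ + M)·B`, so the ramp equals `1` and the smoothstep of `1` is `1`). [folklore] -/
theorem h4_top (hB : 0 < B) (hM : 0 < M) (hIM : I₀ + M < n) :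
    h4 n B M I₀ ((⟨I₀ + M, hIM⟩ : Fin n), (⟨0, hB⟩ : Fin B)) = 1 := by
  have hι : ((ι (((⟨I₀ + M, hIM⟩ : Fin n), (⟨0, hB⟩ : Fin B))) : ℕ) : ℝ) = ((I₀ : ℝ) + M) * B := by
    rw [ι_eq]; push_cast; ring
  rw [h4_eq, ramp_eq_one_of_ge hB hM hι.symm.le, sstep_one]

end Defects

/-! ## §3 The shadow configuration is non-degenerate where the cutoff is `≡ 1` -/

section Shadow

variable {n B M I₀ : ℕ} {a : ℝ} {ha : 16777216 ≤ a} {haB : 2 * a ≤ (B : ℝ)}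

/-- the shadow potential is STRICTLY POSITIVE at the base site `z₀ = (I₀, 0)` of block `I₀` (Toy15's
`vsh_base_ne_zero` and `vsh ≥ 0`). [folklore] -/
theorem vsh_base_pos (hB : 0 < B) (hM : 0 < M) (hI₀ : I₀ < n) (ha0 : 0 < a) :
    0 < vsh n B M I₀ a ((⟨I₀, hI₀⟩ : Fin n), (⟨0, hB⟩ : Fin B)) :=
  lt_of_le_of_ne (vsh_nonneg _) (vsh_base_ne_zero hB hM hI₀ ha0).symm

/-- the propagator defect of the shadow datum in closed form (Toy15's `Xsh := Xhv … vsh …`). [folklore] -/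
theorem Xsh_dG'_apply (x y : Fin n × Fin B) :
    (Xsh n B M I₀ a ha haB).dG' x y =
      h4 n B M I₀ x * Gv n B ((a / B) ^ 2) (vsh n B M I₀ a) x y - Gr n B ((a / B) ^ 2) x y * h4 n B M I₀ y :=
  Xhv_dG'_apply x y

/-- **THE LOCAL DEFECT OF THE SHADOW DATUM VANISHES IDENTICALLY**: `𝔇(A′) = diag(h₄·vsh) = 0` — the cutoff never
sees the potential (`h₄·vsh ≡ 0`, Toy15's `h4_mul_vsh`). [folklore] -/
theorem Xsh_dA'_eq_zero : (Xsh n B M I₀ a ha haB).dA' = 0 := by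
  have e : (Xsh n B M I₀ a ha haB).dA' = Matrix.diagonal fun x => h4 n B M I₀ x * vsh n B M I₀ a x := Xhv_dA'
  have hz : (fun x => h4 n B M I₀ x * vsh n B M I₀ a x) = 0 := funext (h4_mul_vsh (a := a))
  rw [e, hz]
  exact Matrix.diagonal_zero

/-- **THE COMMUTATOR PART**: at the pair (top site `x_top = (I₀ + M, 0)`, base site `z₀ = (I₀, 0)`) — `h₄(x_top) = 1`,
`h₄(z₀) = 0` — the propagator defect of the shadow datum is `𝔇(G′)(x_top, z₀) = G_v(x_top, z₀)`. [folklore] -/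
theorem Xsh_dG'_top_base (hM : 0 < M) (hIM : I₀ + M < n) :
    (Xsh n B M I₀ a ha haB).dG' ((⟨I₀ + M, hIM⟩ : Fin n), (⟨0, hBnat_of ha haB⟩ : Fin B))
        ((⟨I₀, lt_of_hIM hIM⟩ : Fin n), (⟨0, hBnat_of ha haB⟩ : Fin B)) =
      Gv n B ((a / B) ^ 2) (vsh n B M I₀ a) ((⟨I₀ + M, hIM⟩ : Fin n), (⟨0, hBnat_of ha haB⟩ : Fin B))
        ((⟨I₀, lt_of_hIM hIM⟩ : Fin n), (⟨0, hBnat_of ha haB⟩ : Fin B)) := by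
  rw [Xsh_dG'_apply (ha := ha) (haB := haB), h4_top (hBnat_of ha haB) hM hIM,
    h4_base (hBnat_of ha haB) hM (lt_of_hIM hIM), one_mul, mul_zero, sub_zero]

/-- **… AND IT IS STRICTLY POSITIVE** (`Gv_pos`): in particular `𝔇(G′) ≠ 0`. [folklore] -/
theorem Xsh_dG'_top_base_pos (hM : 0 < M) (hIM : I₀ + M < n) :
    0 < (Xsh n B M I₀ a ha haB).dG' ((⟨I₀ + M, hIM⟩ : Fin n), (⟨0, hBnat_of ha haB⟩ : Fin B))
        ((⟨I₀, lt_of_hIM hIM⟩ : Fin n), (⟨0, hBnat_of ha haB⟩ : Fin B)) := by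
  rw [Xsh_dG'_top_base hM hIM]
  exact Gv_pos (muB_pos (ha20_of ha) (haB_of ha haB)) vsh_nonneg vsh_le _ _

/-- **THE PROPAGATOR DEFECT OF THE SHADOW DATUM IS NOT ZERO** (`0 < M`, `I₀ + M < n`). [folklore] -/
theorem Xsh_dG'_ne_zero (hM : 0 < M) (hIM : I₀ + M < n) : (Xsh n B M I₀ a ha haB).dG' ≠ 0 := by
  intro h
  have hp := Xsh_dG'_top_base_pos (ha := ha) (haB := haB) hM hIM
  rw [h, Matrix.zero_apply] at hp
  exact lt_irrefl _ hp

/-- **THE TWO-BACKGROUND PART**: at the diagonal entry of the top site, where `h₄ ≡ 1` and the commutator part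
vanishes, `𝔇(G′)(x_top, x_top) = G_v(x_top, x_top) − G′(x_top, x_top)`. [folklore] -/
theorem Xsh_dG'_top_top (hM : 0 < M) (hIM : I₀ + M < n) :
    (Xsh n B M I₀ a ha haB).dG' ((⟨I₀ + M, hIM⟩ : Fin n), (⟨0, hBnat_of ha haB⟩ : Fin B))
        ((⟨I₀ + M, hIM⟩ : Fin n), (⟨0, hBnat_of ha haB⟩ : Fin B)) =
      Gv n B ((a / B) ^ 2) (vsh n B M I₀ a) ((⟨I₀ + M, hIM⟩ : Fin n), (⟨0, hBnat_of ha haB⟩ : Fin B))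
          ((⟨I₀ + M, hIM⟩ : Fin n), (⟨0, hBnat_of ha haB⟩ : Fin B))
        - Gr n B ((a / B) ^ 2) ((⟨I₀ + M, hIM⟩ : Fin n), (⟨0, hBnat_of ha haB⟩ : Fin B))
          ((⟨I₀ + M, hIM⟩ : Fin n), (⟨0, hBnat_of ha haB⟩ : Fin B)) := by
  rw [Xsh_dG'_apply (ha := ha) (haB := haB), h4_top (hBnat_of ha haB) hM hIM, one_mul, mul_one]

/-- **… AND IT IS STRICTLY NEGATIVE**: the potential hidden behind the foot of the ramp, `M` blocks away, where
`h₄ = 0`, is FELT through the resolvent at the top site where `h₄ = 1` (`Gv_lt_Gr` with the strictly positive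
value of `vsh` at `z₀ = (I₀, 0)`).  This is the genuine two-background content of the shadow configuration.
[folklore] -/
theorem Xsh_dG'_top_top_neg (hM : 0 < M) (hIM : I₀ + M < n) :
    (Xsh n B M I₀ a ha haB).dG' ((⟨I₀ + M, hIM⟩ : Fin n), (⟨0, hBnat_of ha haB⟩ : Fin B))
        ((⟨I₀ + M, hIM⟩ : Fin n), (⟨0, hBnat_of ha haB⟩ : Fin B)) < 0 := by
  rw [Xsh_dG'_top_top hM hIM, sub_neg]
  have ha0 : 0 < a := by linarith
  exact Gv_lt_Gr (muB_pos (ha20_of ha) (haB_of ha haB)) vsh_nonneg vsh_le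
    (vsh_base_pos (hBnat_of ha haB) hM (lt_of_hIM hIM) ha0) _ _

/-- the same as a strict comparison of the two background propagators at the top site:
`G′₂(x_top, x_top) < G′₁(x_top, x_top)`. [folklore] -/
theorem Xsh_G'₂_top_lt_G'₁_top (hM : 0 < M) (hIM : I₀ + M < n) :
    (Xsh n B M I₀ a ha haB).G'₂ ((⟨I₀ + M, hIM⟩ : Fin n), (⟨0, hBnat_of ha haB⟩ : Fin B))
        ((⟨I₀ + M, hIM⟩ : Fin n), (⟨0, hBnat_of ha haB⟩ : Fin B)) <
      (Xsh n B M I₀ a ha haB).G'₁ ((⟨I₀ + M, hIM⟩ : Fin n), (⟨0, hBnat_of ha haB⟩ : Fin B))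
        ((⟨I₀ + M, hIM⟩ : Fin n), (⟨0, hBnat_of ha haB⟩ : Fin B)) := by
  have h := Xsh_dG'_top_top_neg (ha := ha) (haB := haB) hM hIM
  rw [Xsh_dG'_top_top hM hIM, sub_neg] at h
  exact h

/-- **EVERY ENTRY of the two background propagators differs** in the shadow configuration: `G′₂(x, y) < G′₁(x, y)`
for all sites `x, y` (`Gv_lt_Gr`). [folklore] -/
theorem Xsh_G'₂_lt_G'₁ (hM : 0 < M) (hI₀ : I₀ < n) (x y : Fin n × Fin B) :
    (Xsh n B M I₀ a ha haB).G'₂ x y < (Xsh n B M I₀ a ha haB).G'₁ x y := by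
  have ha0 : 0 < a := by linarith
  exact Gv_lt_Gr (muB_pos (ha20_of ha) (haB_of ha haB)) vsh_nonneg vsh_le
    (vsh_base_pos (hBnat_of ha haB) hM hI₀ ha0) x y

/-- **THE COARSE LEVEL — THE TOP BLOCK**: at the diagonal entry of the top block `I_top = I₀ + M` (`h₄(x_S I_top) = 1`)
the coarse-operator defect of the shadow datum is the pure two-background quantity
`𝔇(E)(I_top, I_top) = E_v(I_top, I_top) − E₂(I_top, I_top)`. [folklore] -/
theorem Xsh_dE_top_top (hM : 0 < M) (hIM : I₀ + M < n) :
    (Xsh n B M I₀ a ha haB).dE (⟨I₀ + M, hIM⟩ : Fin n) (⟨I₀ + M, hIM⟩ : Fin n) =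
      Ev n B ((a / B) ^ 2) (vsh n B M I₀ a) (⟨I₀ + M, hIM⟩ : Fin n) (⟨I₀ + M, hIM⟩ : Fin n)
        - E2 n B ((a / B) ^ 2) (⟨I₀ + M, hIM⟩ : Fin n) (⟨I₀ + M, hIM⟩ : Fin n) := by
  have e : (Xsh n B M I₀ a ha haB).dE (⟨I₀ + M, hIM⟩ : Fin n) (⟨I₀ + M, hIM⟩ : Fin n) =
      h4 n B M I₀ (xS (hBnat_of ha haB) (⟨I₀ + M, hIM⟩ : Fin n))
          * Ev n B ((a / B) ^ 2) (vsh n B M I₀ a) (⟨I₀ + M, hIM⟩ : Fin n) (⟨I₀ + M, hIM⟩ : Fin n)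
        - E2 n B ((a / B) ^ 2) (⟨I₀ + M, hIM⟩ : Fin n) (⟨I₀ + M, hIM⟩ : Fin n)
          * h4 n B M I₀ (xS (hBnat_of ha haB) (⟨I₀ + M, hIM⟩ : Fin n)) :=
    Xhv_dE_apply _ _
  have ht : h4 n B M I₀ (xS (hBnat_of ha haB) (⟨I₀ + M, hIM⟩ : Fin n)) = 1 := h4_top (hBnat_of ha haB) hM hIM
  rw [e, ht, one_mul, mul_one]

/-- **… AND IT IS STRICTLY NEGATIVE** (`Ev_lt_E2` with the strictly positive value of `vsh` at `z₀`): on the block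
level where Toy15's headline `𝔇(T)` lives, the shadow configuration has a non-zero two-background defect in the
slot `E` (whose inverse is the slot `C`). [folklore] -/
theorem Xsh_dE_top_top_neg (hM : 0 < M) (hIM : I₀ + M < n) :
    (Xsh n B M I₀ a ha haB).dE (⟨I₀ + M, hIM⟩ : Fin n) (⟨I₀ + M, hIM⟩ : Fin n) < 0 := by
  rw [Xsh_dE_top_top hM hIM, sub_neg]
  have ha0 : 0 < a := by linarith
  exact Ev_lt_E2 (muB_pos (ha20_of ha) (haB_of ha haB)) vsh_nonneg vsh_le
    (vsh_base_pos (hBnat_of ha haB) hM (lt_of_hIM hIM) ha0) (hBnat_of ha haB) _ _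

/-- **THE COARSE-OPERATOR DEFECT OF THE SHADOW DATUM IS NOT ZERO**. [folklore] -/
theorem Xsh_dE_ne_zero (hM : 0 < M) (hIM : I₀ + M < n) : (Xsh n B M I₀ a ha haB).dE ≠ 0 := by
  intro h
  have hp := Xsh_dE_top_top_neg (ha := ha) (haB := haB) hM hIM
  rw [h, Matrix.zero_apply] at hp
  exact lt_irrefl _ hp

/-- **EVERY ENTRY of the two coarse operators differs** in the shadow configuration: `E_v(I, J) < E₂(I, J)`.
[folklore] -/
theorem Xsh_Ev_lt_E2 (ha : 16777216 ≤ a) (haB : 2 * a ≤ (B : ℝ)) (hM : 0 < M) (hI₀ : I₀ < n) (I J : Fin n) :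
    Ev n B ((a / B) ^ 2) (vsh n B M I₀ a) I J < E2 n B ((a / B) ^ 2) I J := by
  have ha0 : 0 < a := by linarith
  exact Ev_lt_E2 (muB_pos (ha20_of ha) (haB_of ha haB)) vsh_nonneg vsh_le
    (vsh_base_pos (hBnat_of ha haB) hM hI₀ ha0) (hBnat_of ha haB) I J

/-- **SUMMARY — THE SHADOW CONFIGURATION IS NOT A DISGUISED EQUAL-SEQUENCE DATUM**: zero local defect `𝔇(A′) = 0`,
non-zero propagator defect `𝔇(G′) ≠ 0`, non-zero coarse-operator defect `𝔇(E) ≠ 0`, different background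
propagators `G′₂ ≠ G′₁`. [folklore] -/
theorem Xsh_nondegenerate (hM : 0 < M) (hIM : I₀ + M < n) :
    (Xsh n B M I₀ a ha haB).dA' = 0 ∧ (Xsh n B M I₀ a ha haB).dG' ≠ 0 ∧ (Xsh n B M I₀ a ha haB).dE ≠ 0
      ∧ (Xsh n B M I₀ a ha haB).G'₂ ≠ (Xsh n B M I₀ a ha haB).G'₁ :=
  ⟨Xsh_dA'_eq_zero, Xsh_dG'_ne_zero hM hIM, Xsh_dE_ne_zero hM hIM, Xsh_G'₂_ne_G'₁ hM (lt_of_hIM hIM)⟩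

end Shadow

end

end Literature.MathematicalPhysics.QuantumFieldTheory.Balaban1983to89.B9SectCDiffCutModelToy16
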